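import Mathlib
import Summits.ResolutionOfSingularities.ResolutionOfSingularities.Theorems.RadicialJungCleanModelsCleanProp44NearLineClassification
import Summits.ResolutionOfSingularities.ResolutionOfSingularities.Theorems.RadicialJungCleanModelsCleanProp44NearLineNoTangentScheme
import HarnessLib

/-!
# Route `RadicialJung`, crux `CleanModels` (stmt-ResolutionOfSingularities-15917), line `Sketch` rev 35, stub 6 `stub_cleanProp44` (X44c):
# CLEAN-PERMISSIBILITY OF NEAR LINES, IX — on a near line only CORNERS and BIRTHS obstruct

Seat decomp-res-hand-2 g18 (structural hand).  The classification ✓ `cleanPermissibleAt_exceptionalCurve_or_obstruction` («permissible ∨ corner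
∨ tangent side ∨ birth», `…CleanProp44NearLineClassification.lean`) combined with no-tangency ✓ `side_trichotomy_nearLine_of_isBlowup`
(`…CleanProp44NearLineNoTangentScheme.lean`): when the regular curve germ `N = (e', y')` of the exceptional divisor is a NEAR LINE — the line of a
regular parameter `t_{j₀}` of `𝒪_{X,x}` (`τ^♯ t_{j₀} = e' · y'`; every line of `E_x = ℙ(𝔪_x/𝔪_x²)` is of this form, the near line of a
`τ = 1` point in particular, [CoP1] Lemma 4.3 (5)) — the tangent disjunct is void:

* `cleanPermissibleAt_nearLine_or_corner_or_birth` — after the blowing up `τ` of a clean point `x` (the line of `G` clean-permissible at `x` for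
  `J_x = 𝔪_x` in form (1)/(2) currency: `(c, w)`, `u`, `a` with every `a_k` zero or prime to `p`, `b = 0`), at every point `x'` of the near line
  with `dim 𝒪_{X',x'} = 3`: the line of `τ^♯ G` is CLEAN-PERMISSIBLE at `x'` for `N`, OR `x'` is a CORNER of the clean divisor met by `N` in a
  non-axis direction, OR `x'` is a BIRTH of `N`.

* (appended) `cleanPermissibleAt_nearLine_of_single_side` — ONE clean component through `x` (one non-zero exponent, prime to `p`): every near line
  over `x` is clean-permissible at EVERY point (no corner, no birth).

This is lemma (ii) of hand-2 g17's census of (R1ᵐⁱⁿ) in its final kernel form: the set of points of a near line where it is not clean-permissible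
is contained in {corners on it} ∪ {births on it} (both finite: ≤ 3 corners per `E_x`; births per memo 4e §2.4 (B2)/(B5)).  Honest framing: OURS;
a TOOL; the termination of «insert – blow up – new near lines» (the research content of (R1ᵐⁱⁿ)) is NOT addressed.  Nothing here proves X44c, any
case of `CleanModels`, or resolution of singularities in characteristic `p`.  Setting only: [cite: CossartPiltant2008, Lemma 4.3 (5); Prop. 4.4]
[cite: Piltant2013, §2 Axiom 4] [cite: GortzWedhorn2020, Prop. 13.91].
-/

noncomputable section

set_option linter.dupNamespace false -- mandated namespace of this single-conjunct summit

open IsLocalRing CategoryTheory AlgebraicGeometry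
open Literature.AlgebraicGeometry.Resolution Literature.AlgebraicGeometry.Motives

namespace Summit.ResolutionOfSingularities.ResolutionOfSingularities.Theorems.RadicialJung.CleanModels

universe u

section Scheme

variable {p : ℕ} {X X' : Scheme.{u}} [IsIntegral X] [IsIntegral X'] {τ : X' ⟶ X} [IsDominant τ]
  {J : X.IdealSheafData}

set_option maxHeartbeats 800000 in
-- long statement, short proof
/-- **On a near line only corners and births obstruct clean-permissibility.**  See the module docstring.
[cite: CossartPiltant2008, Lemma 4.3 (5); Prop. 4.4 (proof, p. 11)] [cite: Piltant2013, §2 Axiom 4] -/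
theorem cleanPermissibleAt_nearLine_or_corner_or_birth [Fact p.Prime] [CharP X'.functionField p] (hτ : IsBlowup τ J) (x' : X')
    (hR : IsRegularLocalRing (X.presheaf.stalk (τ x'))) {n l : ℕ} (c : Fin n → X.presheaf.stalk (τ x'))
    (w : Fin l → X.presheaf.stalk (τ x')) (hz : Ideal.span (Set.range (Fin.append c w)) = maximalIdeal (X.presheaf.stalk (τ x')))
    (hdim : ringKrullDim (X.presheaf.stalk (τ x')) = ((n + l : ℕ) : WithBot ℕ∞))
    (hcJ : Ideal.span (Set.range c) = stalkIdeal J (τ x')) (hJ : stalkIdeal J (τ x') = maximalIdeal (X.presheaf.stalk (τ x')))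
    {G : X.functionField} {cc : Fin p → X.functionField} (hcc : ∃ j : Fin p, (j : ℕ) ≠ 0 ∧ cc j ≠ 0)
    {u : X.presheaf.stalk (τ x')} (hu : IsUnit u) {a : Fin n → ℕ} {b : Fin l → ℕ}
    (hrep : (∑ j : Fin p, cc j ^ p * G ^ (j : ℕ)) = RatFn.toFunctionField (τ x') (u * (∏ k, c k ^ a k) * ∏ m, w m ^ b m))
    (hb : ∀ m, b m = 0) (hall : ∀ k, a k = 0 ∨ ¬ p ∣ a k)
    (hdim' : ringKrullDim (X'.presheaf.stalk x') = 3)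
    -- the near line `N = (e', y')` of the regular parameter `t_{j₀}` through `x'`
    {d : ℕ} (t : Fin d → X.presheaf.stalk (τ x')) (hspan : Ideal.span (Set.range t) = maximalIdeal (X.presheaf.stalk (τ x')))
    (hdimd : ringKrullDim (X.presheaf.stalk (τ x')) = (d : WithBot ℕ∞)) (j₀ : Fin d) {e' y' z' : X'.presheaf.stalk x'}
    (he' : Ideal.span {e'} = (stalkIdeal J (τ x')).map (τ.stalkMap x').hom)
    (hy' : (τ.stalkMap x').hom (t j₀) = e' * y') (hy'm : y' ∈ maximalIdeal (X'.presheaf.stalk x'))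
    (hzz : Ideal.span ({e', y', z'} : Set (X'.presheaf.stalk x')) = maximalIdeal (X'.presheaf.stalk x')) :
    CleanPermissibleAt p (RatFn.toFunctionField x') (RatFn.functionFieldMap τ G) (Ideal.span ({e', y'} : Set (X'.presheaf.stalk x'))) ∨
    (∃ (k₁ k₂ : Fin n) (s₁ s₂ : X'.presheaf.stalk x'), k₁ ≠ k₂ ∧ a k₁ ≠ 0 ∧ a k₂ ≠ 0 ∧
        (τ.stalkMap x').hom (c k₁) = e' * s₁ ∧ (τ.stalkMap x').hom (c k₂) = e' * s₂ ∧
        Ideal.span ({e', s₁, s₂} : Set (X'.presheaf.stalk x')) = maximalIdeal (X'.presheaf.stalk x') ∧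
        s₁ ∉ Ideal.span ({e', y'} : Set (X'.presheaf.stalk x')) ∧ s₂ ∉ Ideal.span ({e', y'} : Set (X'.presheaf.stalk x'))) ∨
    (p ∣ ∑ k, a k ∧ (∀ k, a k ≠ 0 → Ideal.span {(τ.stalkMap x').hom (c k)} = (stalkIdeal J (τ x')).map (τ.stalkMap x').hom) ∧
      ∃ U : X'.presheaf.stalk x', IsUnit U ∧
        (∑ j : Fin p, RatFn.functionFieldMap τ (cc j) ^ p * RatFn.functionFieldMap τ G ^ (j : ℕ)) =
          RatFn.toFunctionField x' (U * e' ^ (∑ k, a k)) ∧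
        ¬ ((∀ c' : X'.presheaf.stalk x', U - c' ^ p ∉ maximalIdeal (X'.presheaf.stalk x')) ∨
          (∃ c' : X'.presheaf.stalk x', U - c' ^ p ∈ maximalIdeal (X'.presheaf.stalk x') ∧
            U - c' ^ p ∉ Ideal.span ({e', y'} : Set (X'.presheaf.stalk x')) ⊔ maximalIdeal (X'.presheaf.stalk x') ^ 2) ∨
          (∃ c' : X'.presheaf.stalk x', U - c' ^ p ∈ Ideal.span ({e', y'} : Set (X'.presheaf.stalk x')) ∧
            U - c' ^ p ∉ maximalIdeal (X'.presheaf.stalk x') ^ 2))) := by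
  rcases cleanPermissibleAt_exceptionalCurve_or_obstruction hτ x' hR c w hz hdim hcJ hcc hu hrep hb hall hdim' he' hzz with
    h | h | ⟨k, s, hak, hs, hsm, hsN, hsN2⟩ | h
  · exact Or.inl h
  · exact Or.inr (Or.inl h)
  · -- the tangent disjunct is void on a near line
    exfalso
    have hck : c k ∈ maximalIdeal (X.presheaf.stalk (τ x')) := hz ▸ Ideal.subset_span ⟨Fin.castAdd l k, by simp⟩
    rw [hJ] at he'
    obtain ⟨s', hs', htri⟩ := side_trichotomy_nearLine_of_isBlowup hτ x' hR t hspan hdimd hJ j₀ he' hy' hy'm hzz hck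
    -- `𝒪_{X',x'}` is regular of dimension `3`; `e' ≠ 0`
    obtain ⟨i, uf, m, jJ, -, -, -, -, -, hrsop, -⟩ := exists_transform_normalForm_of_isBlowup hτ x' hR c w hz hdim hcJ a b hu
    have hR' : IsRegularLocalRing (X'.presheaf.stalk x') := hrsop.isRegularLocalRing
    have hr3 : Set.range ![e', y', s] = {e', y', s} := by
      ext r
      simp only [Set.mem_range, Set.mem_insert_iff, Set.mem_singleton_iff]
      constructor
      · rintro ⟨j, rfl⟩
        fin_cases j <;> simp
      · rintro (rfl | rfl | rfl)
        exacts [⟨0, rfl⟩, ⟨1, rfl⟩, ⟨2, rfl⟩]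
    have he'm : e' ∈ maximalIdeal (X'.presheaf.stalk x') := hzz ▸ Ideal.subset_span (by simp)
    have he'0 : e' ≠ 0 := by
      intro h0
      -- `(0, y', z')` would generate `𝔪` in a `3`-dimensional regular local ring
      have hz3 : IsRsopPart ![e', y', z'] := by
        refine ⟨hR', 0, Fin.elim0, by rw [hdim']; norm_cast, ?_⟩
        have hr : Set.range ![e', y', z'] = {e', y', z'} := by
          ext r
          simp only [Set.mem_range, Set.mem_insert_iff, Set.mem_singleton_iff]
          constructor
          · rintro ⟨j, rfl⟩
            fin_cases j <;> simp
          · rintro (rfl | rfl | rfl)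
            exacts [⟨0, rfl⟩, ⟨1, rfl⟩, ⟨2, rfl⟩]
        rw [Set.range_eq_empty Fin.elim0, Set.union_empty, hr, hzz]
      exact hz3.ne_zero 0 (by simpa using h0)
    have hss : s = s' := mul_left_cancel₀ he'0 (hs.symm.trans hs')
    rcases htri with hunit | htr | hmem
    · exact mem_nonunits_iff.mp ((mem_maximalIdeal _).mp hsm) (hss ▸ hunit)
    · rw [← hss] at htr
      have hz3 : IsRsopPart (Fin.append ![e', y'] ![s]) := by
        have heq : (Fin.append ![e', y'] ![s] : Fin 3 → X'.presheaf.stalk x') = ![e', y', s] := by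
          funext r; fin_cases r <;> rfl
        rw [heq]
        refine ⟨hR', 0, Fin.elim0, by rw [hdim']; norm_cast, ?_⟩
        rw [Set.range_eq_empty Fin.elim0, Set.union_empty, hr3, htr]
      apply append_right_not_mem_span_sup_sq hz3 0
      have hr2 : Set.range ![e', y'] = {e', y'} := by
        ext r
        simp only [Set.mem_range, Set.mem_insert_iff, Set.mem_singleton_iff]
        constructor
        · rintro ⟨j, rfl⟩
          fin_cases j <;> simp
        · rintro (rfl | rfl)
          exacts [⟨0, rfl⟩, ⟨1, rfl⟩]
      simpa [hr2] using hsN2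
    · exact hsN (hss ▸ hmem)
  · exact Or.inr (Or.inr h)

/-- **A single clean component through `x`: every near line is clean-permissible at every point** (no corner — one side only — and no birth —
`A = a_{k₀}` is prime to `p`).  Typical `x`: a form-(3) point (`s - c^p` a regular parameter, exponent `1`), or the uncharged landing point of an
L7b chain. [cite: CossartPiltant2008, Lemma 4.3 (5)] [cite: Piltant2013, §2 Axiom 4] -/
theorem cleanPermissibleAt_nearLine_of_single_side [Fact p.Prime] [CharP X'.functionField p] (hτ : IsBlowup τ J) (x' : X')
    (hR : IsRegularLocalRing (X.presheaf.stalk (τ x'))) {n l : ℕ} (c : Fin n → X.presheaf.stalk (τ x'))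
    (w : Fin l → X.presheaf.stalk (τ x')) (hz : Ideal.span (Set.range (Fin.append c w)) = maximalIdeal (X.presheaf.stalk (τ x')))
    (hdim : ringKrullDim (X.presheaf.stalk (τ x')) = ((n + l : ℕ) : WithBot ℕ∞))
    (hcJ : Ideal.span (Set.range c) = stalkIdeal J (τ x')) (hJ : stalkIdeal J (τ x') = maximalIdeal (X.presheaf.stalk (τ x')))
    {G : X.functionField} {cc : Fin p → X.functionField} (hcc : ∃ j : Fin p, (j : ℕ) ≠ 0 ∧ cc j ≠ 0)
    {u : X.presheaf.stalk (τ x')} (hu : IsUnit u) {a : Fin n → ℕ} {b : Fin l → ℕ}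
    (hrep : (∑ j : Fin p, cc j ^ p * G ^ (j : ℕ)) = RatFn.toFunctionField (τ x') (u * (∏ k, c k ^ a k) * ∏ m, w m ^ b m))
    (hb : ∀ m, b m = 0) (k₀ : Fin n) (hsingle : ∀ k, k ≠ k₀ → a k = 0) (hk₀ : ¬ p ∣ a k₀)
    (hdim' : ringKrullDim (X'.presheaf.stalk x') = 3)
    {d : ℕ} (t : Fin d → X.presheaf.stalk (τ x')) (hspan : Ideal.span (Set.range t) = maximalIdeal (X.presheaf.stalk (τ x')))
    (hdimd : ringKrullDim (X.presheaf.stalk (τ x')) = (d : WithBot ℕ∞)) (j₀ : Fin d) {e' y' z' : X'.presheaf.stalk x'}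
    (he' : Ideal.span {e'} = (stalkIdeal J (τ x')).map (τ.stalkMap x').hom)
    (hy' : (τ.stalkMap x').hom (t j₀) = e' * y') (hy'm : y' ∈ maximalIdeal (X'.presheaf.stalk x'))
    (hzz : Ideal.span ({e', y', z'} : Set (X'.presheaf.stalk x')) = maximalIdeal (X'.presheaf.stalk x')) :
    CleanPermissibleAt p (RatFn.toFunctionField x') (RatFn.functionFieldMap τ G) (Ideal.span ({e', y'} : Set (X'.presheaf.stalk x'))) := by
  have hall : ∀ k, a k = 0 ∨ ¬ p ∣ a k := fun k => by
    by_cases hk : k = k₀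
    · exact Or.inr (hk ▸ hk₀)
    · exact Or.inl (hsingle k hk)
  rcases cleanPermissibleAt_nearLine_or_corner_or_birth hτ x' hR c w hz hdim hcJ hJ hcc hu hrep hb hall hdim' t hspan hdimd j₀ he' hy' hy'm
      hzz with h | ⟨k₁, k₂, -, -, hk, hk₁, hk₂, -⟩ | ⟨hA, -⟩
  · exact h
  · exfalso
    by_cases h₁ : k₁ = k₀
    · exact hk₂ (hsingle k₂ fun h₂ => hk (h₁.trans h₂.symm))
    · exact hk₁ (hsingle k₁ h₁)
  · exfalso
    apply hk₀
    have hsum : ∑ k, a k = a k₀ := by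
      rw [Finset.sum_eq_single k₀ (fun k _ hk => hsingle k hk) (fun h => absurd (Finset.mem_univ _) h)]
    rwa [hsum] at hA

end Scheme

end Summit.ResolutionOfSingularities.ResolutionOfSingularities.Theorems.RadicialJung.CleanModels

end
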